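import Summits.CriticalPhenomena.Ising3DConformalLimit.Theses.FKParityRobustness
import Literature.Probability.LatticeModels.RandomClusterFKG
import Literature.Probability.LatticeModels.RandomClusterProofs
import Literature.Probability.LatticeModels.IsingTransport
import Literature.Probability.LatticeModels.CriticalUrsellFourSign
import Literature.Probability.LatticeModels.CriticalTwoPointBounds
import Literature.Probability.Percolation.PercolationEvents

/-!
# Disproof of `FKFourConnectivity` — findings (cdisprove seat, stmt-CriticalPhenomena-11254, route FKParityRobustness)

Crux (P4, "FK four-point hyperscaling on ℤ³"): `∃ c > 0, ∀ l ≥ 1, ∃ N₀, ∀ N ≥ N₀`, for the tetrahedron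
`a = l·tetra ⊂ Λ_N = {−N..N}³` and the free FK-Ising measure `φ_N = rcMeasure ((zdGraph 3).comap val) (fkIsingParam β_c(3)) 2 ∅`:
`c·φ_N(a₀↔a₁)·φ_N(a₂↔a₃) ≤ φ_N(all four joined)`.

VERDICT SO FAR: **no kill; resists for a structural reason, now fully kernel-checked** (§2b,
`not_FKFourConnectivity_imp_not_latticeBound`, axioms {propext, choice, Quot.sound}):
  ¬FKFourConnectivity → ¬(∃ c > 0, ∀ l ≥ 1, U₄^crit(l·tetra) ≤ −c·⟨σσ⟩_{β_c}⟨σσ⟩_{β_c}),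
i.e. the crux is NECESSARY for the conclusion of the route's `LatticeBoundFromFK` (= the hypothesis of
`FarMergingGivesU4` at the tetrahedral shape). A counterexample to the crux is therefore a proof that the critical
3D Ising four-point function is pointwise trivial along tetrahedra (`liminf |U₄(A_l)|/G² = 0`), against clause (iii)
and the bootstrap value `g(u=v=1) < 3`; nobody can prove that. Chain (all in this file): Edwards–Sokal two- and
four-point (§1b, PROVED here) + FKG + counting (§1) give `−2φ_N(ALL) ≤ U₄^free_{Λ_N}` on the box graph (§1c); transport
box graph ↔ ℤ³-in-the-box (`isingExpect_free_map`), box limits at β_c (`criticalCorr_wellDefined_holds`,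
`tendsto_connectedFour_box_criticalBeta`) and positivity of `⟨σσ⟩_{β_c}` (`criticalTwoPoint_bounds_holds`) pass an
infinite-volume bound to large boxes with constant c/8 (`eventually_box_bound_of_latticeBound`).
So the crux is the WEAKEST statement on any pointwise-tetrahedral line: every route proving the lattice bound
proves it; refuting it kills them all (planner's KILL CRITERIA, now a theorem).

LANDED (gate): p74034 ACCEPTED → `Theorems/FKFourConnectivity/Negative/LebowitzSandwich.lean` (§1 + §2 FK form + junk
regime); p75774 ACCEPTED → `…/Negative/EdwardsSokalFour.lean` (§1b ES four-point, §1c spin sandwich + ceiling, §2 spin form);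
p76809 ACCEPTED → `…/Negative/LatticeNecessity.lean` (§2b transport + lattice necessity). Import those three modules
(namespace `Summit.CriticalPhenomena.Ising3DConformalLimit.Theorems.FKFourConnectivity.Negative`) instead of this work file.

What was checked (all `theorem`s below are sorry-free):
* §1 `pairProducts_sub_even_le_two_mul_allJoined`: the FK-side Lebowitz sandwich `Σ_π φ(ij)φ(kl) − φ(EVEN) ≤ 2φ(ALL)` for every
  finite graph, `0 ≤ p ≤ 1`, `q ≥ 1`, any wiring (necessity of the crux for any `|U₄(A_l)| ≥ cG²` bound; the route's claim
  "P4 is NECESSARY" is now a theorem, not a remark). `crux_pointwise_of_U4bound`: the one-graph algebra `2cGG ≤ |U₄|_FK ⇒ cGG ≤ P₄`.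
* §1b `edwardsSokal_fourPoint` (NEW, sorry-free): `⟨σ_{a0}σ_{a1}σ_{a2}σ_{a3}⟩^free_G = φ_{G,p,2}(EVEN)` on every finite
  graph (Grimmett Thm 1.16 run with four points: cluster flip at a site whose cluster holds an odd number of marked
  sites, `exists_flipCluster_neg`). This is also the dictionary entry ParityBound (8466) starts from.
* §1c `neg_two_mul_allJoined_le_connectedFour`: `−2·φ_{G,p,2}(ALL) ≤ connectedFour (isingMeasure G univ β 0 free) spinAt a`
  — Aizenman's `|U₄| ≤ 2P₄` as a Lean theorem on finite graphs; with ParityBound it is the sandwich `2∫u ≤ |U₄| ≤ 2P₄`.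
* §1c `allJoined_le_sum_pairProducts` (ceiling): `φ(ALL) ≤ Σ_π φ(ij)φ(kl)` on every finite graph (ALL ⊆ EVEN, ES4, Lebowitz
  `lebowitz_holds`, ES2) ⇒ for the tetrahedron `r(l) = P₄/(G₀₁G₂₃) ≤ 3`: no constant `c > 3` can work (tightness ceiling).
* §1 degenerate regimes: `rcMeasure_zero_eq_dirac` (p = 0 ⇒ φ = δ_∅), `dirac_empty_real_openConn`, `openConn_self`,
  `allJoined_const` — dropping `1 ≤ l` only forces `c ≤ 1` (cosmetic hypothesis); `p = 0` makes the inequality `0 ≤ 0`.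
* §2 `fkFourAt_criticalBeta_iff` (read-back: the parametrised `FKFourAt (criticalBeta 3)` is the crux by `Iff.rfl`),
  `pinned_ne` (the four sites are distinct for `l ≥ 1`), `fkFourAt_zero` (the β = 0 junk analogue HOLDS — so the junk end
  gives neither a refutation nor information; content rests on `criticalBeta_pos_holds`),
  `not_FKFourConnectivity_imp_pointwise_fk_triviality` (what ¬crux means).
* No junk in the signature (confirming rattack-11054/11254, grounder g26-8): centred box, `a` exists iff `l ≤ N` (vacuous
  only below `N₀`), finite Dirac sum = genuine probability measure, all sets measurable (finite type), no `/`, ℕ-`-`, `tsum`, `sSup`.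
* Reformulation (volume monotonicity of free FK on increasing events, q ≥ 1): crux ⇔ `inf_{l≥1} Φ[A_l joined]/(Φ[a₀↔a₁]Φ[a₂↔a₃]) > 0`
  for the (unique, ADS2015) infinite-volume critical FK-Ising measure Φ on ℤ³.
* LOAD-BEARING: the shape constraint `a = l·tetra` (pairs at mutual distance ≍ l) — without it `a₀=a₁=x`, `a₂=a₃=y` far apart
  gives `c ≤ φ(x↔y) → 0` (needs the decay `G ≤ C/|x|`, in tree as `criticalTwoPoint_bounds_holds`; not formalised here);
  criticality AND q = 2 (in any massive regime `P₄/G² → 0` exponentially: Steiner tree of the regular tetrahedron ≈ 2.44·side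
  > 2·side; at a first-order point the free measure is massive — barrier `RandomClusterFirstOrder`); d = 3 is NOT obviously
  load-bearing for P4 itself (unlike BLOB/X4): above d = 6 the percolation analogue fails by the tree-graph bound
  (ratio ≍ L^{6−d}), for 3 ≤ d < 6 hyperscaling heuristics give a plateau.
* NATURAL STRENGTHENINGS under test by Monte Carlo (kit jobs j007942 small / j007949 medium / j007953 large, Swendsen–Wang at
  β_c = 0.221654626, tori L ≤ 128 translation-averaged + free boxes N ≤ 32 centred; evidence auto-attaches to the item):
  r(l) = P₄/(G₀₁G₂₃) plateau vs decay (the crux), c = 1?, uniformity down to N = l (corners, no N₀), cond = P₄/φ(E₀₁,₂₃),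
  Q = U₄/GG → Q* < 0 (lattice non-triviality at the tetrahedron), Lebowitz fraction |U₄|/(2P₄).
  Exact 2×2×2 free cube at p_c (enumeration, this seat): G(face diag) = 0.10860, P₄ = 0.01395, r = 1.183, U₄^FK = −0.00773,
  |U₄|/(2P₄) = 0.277 — the sandwich is far from saturated already on the smallest graph.
* Targets: none yet (no line picked; `payload.targets = []`).

Not a refutation avenue (recorded so nobody re-walks it): small finite models cannot bite (∃N₀ absorbs every finite box);
`decide`/`norm_num` shapes absent (real measure values at a transcendental p); the only falsifier is asymptotic in l.
-/

namespace Summit.CriticalPhenomena.Ising3DConformalLimit.Cruxes.FKFourConnectivity.Disproof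

open MeasureTheory Finset
open Literature.Probability.LatticeModels Literature.Probability.Percolation

noncomputable section

/-! ## 1. The FK-side Lebowitz sandwich on an arbitrary finite graph -/

section Sandwich

variable {V : Type*}

/-- The event "all four marked vertices lie in one open cluster" (the conclusion event of the crux). -/
def allJoined (a : Fin 4 → V) : Set (BondConfig V) :=
  {ω | ∀ i j, (openGraph ω).Reachable (a i) (a j)}

/-- The pairing event `{a i ↔ a j} ∩ {a k ↔ a l}`. -/
def pairJoined (a : Fin 4 → V) (i j k l : Fin 4) : Set (BondConfig V) :=
  openConn (a i) (a j) ∩ openConn (a k) (a l)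

/-- The event "every open cluster contains an even number of the four marked vertices"
(= the union of the three pairing events; by Edwards–Sokal its FK-Ising probability is `⟨σ_{a0}σ_{a1}σ_{a2}σ_{a3}⟩`). -/
def evenJoined (a : Fin 4 → V) : Set (BondConfig V) :=
  (pairJoined a 0 1 2 3 ∪ pairJoined a 0 2 1 3) ∪ pairJoined a 0 3 1 2

/-- A hub vertex joined to all four marked vertices joins them all. [folklore] -/
theorem allJoined_of_hub {a : Fin 4 → V} {ω : BondConfig V}
    (h : ∀ i, (openGraph ω).Reachable (a 0) (a i)) : ω ∈ allJoined a := by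
  intro i j
  exact (h i).symm.trans (h j)

/-- Two different pairing events force all four points into one cluster (pairings 01|23 and 02|13). [folklore] -/
theorem allJoined_of_pair01_pair02 {a : Fin 4 → V} {ω : BondConfig V}
    (h1 : ω ∈ pairJoined a 0 1 2 3) (h2 : ω ∈ pairJoined a 0 2 1 3) : ω ∈ allJoined a := by
  obtain ⟨h01, h23⟩ := h1
  obtain ⟨h02, _⟩ := h2
  refine allJoined_of_hub fun i => ?_
  fin_cases i
  · exact SimpleGraph.Reachable.refl _
  · exact h01
  · exact h02
  · exact h02.trans h23

/-- Two different pairing events force all four points into one cluster (pairings 01|23 and 03|12). [folklore] -/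
theorem allJoined_of_pair01_pair03 {a : Fin 4 → V} {ω : BondConfig V}
    (h1 : ω ∈ pairJoined a 0 1 2 3) (h3 : ω ∈ pairJoined a 0 3 1 2) : ω ∈ allJoined a := by
  obtain ⟨h01, h23⟩ := h1
  obtain ⟨h03, _⟩ := h3
  refine allJoined_of_hub fun i => ?_
  fin_cases i
  · exact SimpleGraph.Reachable.refl _
  · exact h01
  · exact h03.trans h23.symm
  · exact h03

/-- Two different pairing events force all four points into one cluster (pairings 02|13 and 03|12). [folklore] -/
theorem allJoined_of_pair02_pair03 {a : Fin 4 → V} {ω : BondConfig V}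
    (h2 : ω ∈ pairJoined a 0 2 1 3) (h3 : ω ∈ pairJoined a 0 3 1 2) : ω ∈ allJoined a := by
  obtain ⟨h02, _⟩ := h2
  obtain ⟨h03, h12⟩ := h3
  refine allJoined_of_hub fun i => ?_
  fin_cases i
  · exact SimpleGraph.Reachable.refl _
  · exact h02.trans h12.symm
  · exact h02
  · exact h03

/-- `ALL` is contained in every pairing event. [folklore] -/
theorem pairJoined_of_allJoined {a : Fin 4 → V} {ω : BondConfig V} (h : ω ∈ allJoined a)
    (i j k l : Fin 4) : ω ∈ pairJoined a i j k l :=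
  ⟨h i j, h k l⟩

/-- Membership in `EVEN` is the disjunction of the three pairing events. [folklore] -/
theorem evenJoined_iff {a : Fin 4 → V} {ω : BondConfig V} :
    ω ∈ evenJoined a ↔ ω ∈ pairJoined a 0 1 2 3 ∨ ω ∈ pairJoined a 0 2 1 3 ∨ ω ∈ pairJoined a 0 3 1 2 := by
  simp only [evenJoined, Set.mem_union, or_assoc]

/-- The elementary real-number inequality behind the pointwise count
`1[E₁] + 1[E₂] + 1[E₃] ≤ 1[E₁ ∪ E₂ ∪ E₃] + 2·1[ALL]` (any two pairing events force `ALL`). -/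
theorem ite_count_le (c : ℝ) (hc : 0 ≤ c) (P1 P2 P3 PA PE : Prop) [Decidable P1] [Decidable P2]
    [Decidable P3] [Decidable PA] [Decidable PE]
    (h12 : P1 → P2 → PA) (h13 : P1 → P3 → PA) (h23 : P2 → P3 → PA)
    (hA1 : PA → P1) (hA2 : PA → P2) (hA3 : PA → P3) (hE : P1 ∨ P2 ∨ P3 → PE) :
    (if P1 then c else 0) + (if P2 then c else 0) + (if P3 then c else 0) ≤
      (if PE then c else 0) + 2 * (if PA then c else 0) := by
  by_cases hA : PA
  · have h1 := hA1 hA; have h2 := hA2 hA; have h3 := hA3 hA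
    have he := hE (Or.inl h1)
    simp only [h1, h2, h3, he, hA, if_true]
    linarith
  · by_cases h1 : P1 <;> by_cases h2 : P2 <;> by_cases h3 : P3
    · exact absurd (h12 h1 h2) hA
    · exact absurd (h12 h1 h2) hA
    · exact absurd (h13 h1 h3) hA
    · have he := hE (Or.inl h1)
      simp only [h1, h2, h3, he, hA, if_true, if_false]; linarith
    · exact absurd (h23 h2 h3) hA
    · have he := hE (Or.inr (Or.inl h2))
      simp only [h1, h2, h3, he, hA, if_true, if_false]; linarith
    · have he := hE (Or.inr (Or.inr h3))
      simp only [h1, h2, h3, he, hA, if_true, if_false]; linarith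
    · simp only [h1, h2, h3, hA, if_false]
      split_ifs <;> linarith

variable [Fintype V] [DecidableEq V] (G : SimpleGraph V) [DecidableRel G.Adj]

/-- **Pointwise-count inequality, integrated**: for any random-cluster measure `φ = φ^B_{G,p,q}`
(`0 ≤ p ≤ 1`, `0 < q`) and any four vertices,
`φ(E₀₁,₂₃) + φ(E₀₂,₁₃) + φ(E₀₃,₁₂) ≤ φ(EVEN) + 2 φ(ALL)` (in fact an equality, inclusion–exclusion). -/
theorem sum_pairJoined_le {p q : ℝ} (hp : p ∈ Set.Icc (0 : ℝ) 1) (hq : 0 < q) (B : Set V)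
    (a : Fin 4 → V) :
    (rcMeasure G p q B).real (pairJoined a 0 1 2 3) + (rcMeasure G p q B).real (pairJoined a 0 2 1 3)
        + (rcMeasure G p q B).real (pairJoined a 0 3 1 2) ≤
      (rcMeasure G p q B).real (evenJoined a) + 2 * (rcMeasure G p q B).real (allJoined a) := by
  classical
  simp only [rcMeasure_real_apply G hp hq]
  rw [Finset.mul_sum, ← Finset.sum_add_distrib, ← Finset.sum_add_distrib, ← Finset.sum_add_distrib]
  refine Finset.sum_le_sum fun ω _ => ?_
  have hc : 0 ≤ rcWeight G p q B ω / rcPartitionFunction G p q B :=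
    div_nonneg (rcWeight_nonneg G hp hq.le B ω) (rcPartitionFunction_pos G hp hq B).le
  exact ite_count_le _ hc _ _ _ _ _
    (fun h1 h2 => allJoined_of_pair01_pair02 h1 h2)
    (fun h1 h3 => allJoined_of_pair01_pair03 h1 h3)
    (fun h2 h3 => allJoined_of_pair02_pair03 h2 h3)
    (fun h => pairJoined_of_allJoined h 0 1 2 3)
    (fun h => pairJoined_of_allJoined h 0 2 1 3)
    (fun h => pairJoined_of_allJoined h 0 3 1 2)
    (fun h => evenJoined_iff.2 h)

/-- **FK-side Lebowitz sandwich** (necessity of the crux): for `0 ≤ p ≤ 1`, `q ≥ 1`,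
`Σ_π φ(a_i↔a_j) φ(a_k↔a_l) − φ(EVEN) ≤ 2 φ(ALL)`.
With Edwards–Sokal (`φ(x↔y) = ⟨σ_xσ_y⟩`, `φ(EVEN) = ⟨σ_A⟩`) the left side is `−U₄(a)`, so this is
`|U₄| ≤ 2 P₄`: any lower bound `|U₄(A_l)| ≥ c G²` forces the crux `P₄ ≥ (c/2) G²`. Uses only FKG
(`rcMeasure_fkg_holds`, in tree) and the pointwise count. -/
theorem pairProducts_sub_even_le_two_mul_allJoined {p q : ℝ} (hp : p ∈ Set.Icc (0 : ℝ) 1)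
    (hq : 1 ≤ q) (B : Set V) (a : Fin 4 → V) :
    (rcMeasure G p q B).real (openConn (a 0) (a 1)) * (rcMeasure G p q B).real (openConn (a 2) (a 3))
      + (rcMeasure G p q B).real (openConn (a 0) (a 2)) * (rcMeasure G p q B).real (openConn (a 1) (a 3))
      + (rcMeasure G p q B).real (openConn (a 0) (a 3)) * (rcMeasure G p q B).real (openConn (a 1) (a 2))
      - (rcMeasure G p q B).real (evenJoined a) ≤
      2 * (rcMeasure G p q B).real (allJoined a) := by
  have hq0 : 0 < q := one_pos.trans_le hq
  have f1 := rcMeasure_fkg_holds G hp hq B (isUpperSet_openConn (a 0) (a 1)) (isUpperSet_openConn (a 2) (a 3))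
  have f2 := rcMeasure_fkg_holds G hp hq B (isUpperSet_openConn (a 0) (a 2)) (isUpperSet_openConn (a 1) (a 3))
  have f3 := rcMeasure_fkg_holds G hp hq B (isUpperSet_openConn (a 0) (a 3)) (isUpperSet_openConn (a 1) (a 2))
  have hs := sum_pairJoined_le G hp hq0 B a
  simp only [pairJoined] at hs
  linarith

/-- In particular `φ(a₀↔a₁) φ(a₂↔a₃) − φ(EVEN) ≤ 2 φ(ALL)` is NOT available: only the sum over the three
pairings is controlled; but the single-pairing FKG bound `φ(a₀↔a₁) φ(a₂↔a₃) ≤ φ(E₀₁,₂₃)` is. -/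
theorem pairProduct_le_pairJoined {p q : ℝ} (hp : p ∈ Set.Icc (0 : ℝ) 1) (hq : 1 ≤ q) (B : Set V)
    (a : Fin 4 → V) :
    (rcMeasure G p q B).real (openConn (a 0) (a 1)) * (rcMeasure G p q B).real (openConn (a 2) (a 3)) ≤
      (rcMeasure G p q B).real (pairJoined a 0 1 2 3) :=
  rcMeasure_fkg_holds G hp hq B (isUpperSet_openConn (a 0) (a 1)) (isUpperSet_openConn (a 2) (a 3))


/-- From a two-sided bound to the crux inequality, on one graph (pure algebra given the sandwich):
if `2c·φ(a₀↔a₁)φ(a₂↔a₃) ≤ Σ_π φφ − φ(EVEN)` then `c·φ(a₀↔a₁)·φ(a₂↔a₃) ≤ φ(ALL)`. -/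
theorem crux_pointwise_of_U4bound {p q : ℝ} (hp : p ∈ Set.Icc (0 : ℝ) 1) (hq : 1 ≤ q) (B : Set V)
    (a : Fin 4 → V) (c : ℝ)
    (h : 2 * c * ((rcMeasure G p q B).real (openConn (a 0) (a 1)) * (rcMeasure G p q B).real (openConn (a 2) (a 3))) ≤
      (rcMeasure G p q B).real (openConn (a 0) (a 1)) * (rcMeasure G p q B).real (openConn (a 2) (a 3))
      + (rcMeasure G p q B).real (openConn (a 0) (a 2)) * (rcMeasure G p q B).real (openConn (a 1) (a 3))
      + (rcMeasure G p q B).real (openConn (a 0) (a 3)) * (rcMeasure G p q B).real (openConn (a 1) (a 2))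
      - (rcMeasure G p q B).real (evenJoined a)) :
    c * (rcMeasure G p q B).real (openConn (a 0) (a 1)) * (rcMeasure G p q B).real (openConn (a 2) (a 3)) ≤
      (rcMeasure G p q B).real (allJoined a) := by
  have hs := pairProducts_sub_even_le_two_mul_allJoined G hp hq B a
  nlinarith [hs, h]

/-! ### Degenerate regimes: `p = 0` (β = 0) and coincident points (l = 0) -/

/-- The random-cluster weight at `p = 0` vanishes off the empty configuration. -/
theorem rcWeight_zero_of_ne_empty (q : ℝ) (B : Set V) {ω : Finset (Sym2 V)} (hω : ω ≠ ∅) :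
    rcWeight G 0 q B ω = 0 := by
  have : #ω ≠ 0 := by rwa [Ne, Finset.card_eq_zero]
  simp [rcWeight, zero_pow this]

/-- At `p = 0` the partition function is the weight of the empty configuration. -/
theorem rcPartitionFunction_zero (q : ℝ) (B : Set V) :
    rcPartitionFunction G 0 q B = rcWeight G 0 q B ∅ := by
  unfold rcPartitionFunction
  rw [← Finset.add_sum_erase _ _ (Finset.empty_mem_powerset _), Finset.sum_eq_zero, add_zero]
  intro ω hω
  exact rcWeight_zero_of_ne_empty G q B (Finset.ne_of_mem_erase hω)

/-- **Junk/degenerate regime `p = 0`**: the random-cluster measure at `p = 0` is the point mass at the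
closed configuration (so every connection probability between distinct points is `0` and the crux
inequality reads `0 ≤ 0`). The crux lives at `p = fkIsingParam (criticalBeta 3) > 0`
(`criticalBeta_pos_holds`), so no refutation and no cheap proof comes from this end. -/
theorem rcMeasure_zero_eq_dirac {q : ℝ} (hq : 0 < q) (B : Set V) :
    rcMeasure G 0 q B = Measure.dirac (∅ : BondConfig V) := by
  have hZ : rcPartitionFunction G 0 q B = rcWeight G 0 q B ∅ := rcPartitionFunction_zero G q B
  have hw : rcWeight G 0 q B ∅ ≠ 0 := by
    simp [rcWeight, hq.ne']
  unfold rcMeasure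
  rw [← Finset.add_sum_erase _ _ (Finset.empty_mem_powerset _), Finset.sum_eq_zero, add_zero, hZ,
    div_self hw, ENNReal.ofReal_one, one_smul, Finset.coe_empty]
  intro ω hω
  rw [rcWeight_zero_of_ne_empty G q B (Finset.ne_of_mem_erase hω), zero_div, ENNReal.ofReal_zero, zero_smul]

omit [Fintype V] [DecidableEq V] in
/-- Under the point mass at the closed configuration, distinct points are never joined. -/
theorem dirac_empty_real_openConn [Countable V] {x y : V} (hxy : x ≠ y) :
    (Measure.dirac (∅ : BondConfig V)).real (openConn x y) = 0 := by
  have hmem : (∅ : BondConfig V) ∉ openConn x y := by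
    intro h
    simp only [openConn, Set.mem_setOf_eq, openGraph, SimpleGraph.fromEdgeSet_empty,
      SimpleGraph.reachable_bot] at h
    exact hxy h
  rw [measureReal_def, Measure.dirac_apply, Set.indicator_of_notMem hmem, ENNReal.toReal_zero]

/-- `fkIsingParam 0 = 0`: inverse temperature `0` is edge density `0`. -/
theorem fkIsingParam_zero : fkIsingParam 0 = 0 := by simp [fkIsingParam]

omit [Fintype V] [DecidableEq V] in
/-- Coincident points (`l = 0` in the crux, excluded by `1 ≤ l`): every event in sight is `univ`, so
dropping `1 ≤ l` only forces `c ≤ 1` — the hypothesis is cosmetic, not load-bearing. -/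
theorem openConn_self (x : V) : openConn x x = (Set.univ : Set (BondConfig V)) := by
  ext ω; simp [openConn]

omit [Fintype V] [DecidableEq V] in
/-- For coincident points `ALL = univ`. [folklore] -/
theorem allJoined_const (x : V) : allJoined (fun _ : Fin 4 => x) = (Set.univ : Set (BondConfig V)) := by
  ext ω
  simp only [allJoined, Set.mem_setOf_eq, Set.mem_univ, iff_true]
  intro i j
  exact SimpleGraph.Reachable.refl _

end Sandwich

/-! ## 1b. Edwards–Sokal for the four-point function (proved; needed by ParityBound too) -/

section EdwardsSokalFour

variable {V : Type*}

open Classical in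
/-- Flip the spins on the cluster of `v` in `H` (the involution of Grimmett 2006, proof of Thm. 1.16). [cite: Grimmett2006, §1.4 Thm. 1.16] -/
def flipCluster (H : SimpleGraph V) (v : V) (σ : SpinConfig V) : SpinConfig V :=
  fun w => if H.Reachable v w then -σ w else σ w

/-- Flipping a cluster twice is the identity. [folklore] -/
theorem flipCluster_involutive (H : SimpleGraph V) (v : V) : Function.Involutive (flipCluster H v) := by
  intro σ
  funext w
  by_cases hw : H.Reachable v w <;> simp [flipCluster, hw]

/-- On the flipped cluster the spin changes sign. [folklore] -/
theorem spinAt_flipCluster_of_reachable {H : SimpleGraph V} {v w : V} (hw : H.Reachable v w) (σ : SpinConfig V) :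
    spinAt w (flipCluster H v σ) = -spinAt w σ := by
  simp [spinAt, flipCluster, if_pos hw]

/-- Off the flipped cluster the spin is unchanged. [folklore] -/
theorem spinAt_flipCluster_of_not_reachable {H : SimpleGraph V} {v w : V} (hw : ¬ H.Reachable v w) (σ : SpinConfig V) :
    spinAt w (flipCluster H v σ) = spinAt w σ := by
  simp [spinAt, flipCluster, if_neg hw]

/-- Flipping a cluster preserves the event `F` = "constant along the open edges". [cite: Grimmett2006, §1.4 Thm. 1.16] -/
theorem forall_bondSpin_flipCluster_iff (ω : Finset (Sym2 V)) (v : V) (σ : SpinConfig V) :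
    (∀ e ∈ ω, bondSpin (flipCluster (openGraph (↑ω : BondConfig V)) v σ) e = 1) ↔ ∀ e ∈ ω, bondSpin σ e = 1 := by
  set H : SimpleGraph V := openGraph (↑ω : BondConfig V) with hH
  have key : ∀ {x y : V}, H.Adj x y → (H.Reachable v x ↔ H.Reachable v y) := fun hxy =>
    ⟨fun h' => h'.trans hxy.reachable, fun h' => h'.trans hxy.symm.reachable⟩
  rw [forall_bondSpin_eq_one_iff, forall_bondSpin_eq_one_iff]
  constructor
  · intro h' x y hxy
    have hxy' := h' hxy
    by_cases hx : H.Reachable v x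
    · have hy : H.Reachable v y := (key hxy).1 hx
      simp only [flipCluster, if_pos hx, if_pos hy, neg_inj] at hxy'
      exact hxy'
    · have hy : ¬ H.Reachable v y := fun hy => hx ((key hxy).2 hy)
      simp only [flipCluster, if_neg hx, if_neg hy] at hxy'
      exact hxy'
  · intro h' x y hxy
    by_cases hx : H.Reachable v x
    · have hy : H.Reachable v y := (key hxy).1 hx
      simp only [flipCluster, if_pos hx, if_pos hy, h' hxy]
    · have hy : ¬ H.Reachable v y := fun hy => hx ((key hxy).2 hy)
      simp only [flipCluster, if_neg hx, if_neg hy, h' hxy]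

/-- If no pairing of the four marked vertices is realised by the clusters of `H`, some vertex's
cluster contains an odd number of them: flipping that cluster reverses the sign of the spin
four-product `σ_{a0}σ_{a1}σ_{a2}σ_{a3}`. [cite: Grimmett2006, §1.4 Thm. 1.16] -/
theorem exists_flipCluster_neg {H : SimpleGraph V} {a : Fin 4 → V}
    (h : ¬ ((H.Reachable (a 0) (a 1) ∧ H.Reachable (a 2) (a 3)) ∨
      (H.Reachable (a 0) (a 2) ∧ H.Reachable (a 1) (a 3)) ∨
      (H.Reachable (a 0) (a 3) ∧ H.Reachable (a 1) (a 2)))) :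
    ∃ v : V, ∀ σ : SpinConfig V, spinMonomial a (flipCluster H v σ) = -spinMonomial a σ := by
  have r00 : H.Reachable (a 0) (a 0) := SimpleGraph.Reachable.refl _
  have r11 : H.Reachable (a 1) (a 1) := SimpleGraph.Reachable.refl _
  have r22 : H.Reachable (a 2) (a 2) := SimpleGraph.Reachable.refl _
  by_cases r01 : H.Reachable (a 0) (a 1) <;> by_cases r02 : H.Reachable (a 0) (a 2) <;>
    by_cases r03 : H.Reachable (a 0) (a 3)
  · exact absurd (Or.inl ⟨r01, r02.symm.trans r03⟩) h
  · refine ⟨a 0, fun σ => ?_⟩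
    simp only [spinMonomial, Fin.prod_univ_four, spinAt_flipCluster_of_reachable r00,
      spinAt_flipCluster_of_reachable r01, spinAt_flipCluster_of_reachable r02,
      spinAt_flipCluster_of_not_reachable r03]
    ring
  · refine ⟨a 0, fun σ => ?_⟩
    simp only [spinMonomial, Fin.prod_univ_four, spinAt_flipCluster_of_reachable r00,
      spinAt_flipCluster_of_reachable r01, spinAt_flipCluster_of_not_reachable r02,
      spinAt_flipCluster_of_reachable r03]
    ring
  · -- only 0~1: flip the cluster of a 2
    have r20 : ¬ H.Reachable (a 2) (a 0) := fun h' => r02 h'.symm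
    have r21 : ¬ H.Reachable (a 2) (a 1) := fun h' => r02 (r01.trans h'.symm)
    have r23 : ¬ H.Reachable (a 2) (a 3) := fun h' => h (Or.inl ⟨r01, h'⟩)
    refine ⟨a 2, fun σ => ?_⟩
    simp only [spinMonomial, Fin.prod_univ_four, spinAt_flipCluster_of_not_reachable r20,
      spinAt_flipCluster_of_not_reachable r21, spinAt_flipCluster_of_reachable r22,
      spinAt_flipCluster_of_not_reachable r23]
    ring
  · refine ⟨a 0, fun σ => ?_⟩
    simp only [spinMonomial, Fin.prod_univ_four, spinAt_flipCluster_of_reachable r00,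
      spinAt_flipCluster_of_not_reachable r01, spinAt_flipCluster_of_reachable r02,
      spinAt_flipCluster_of_reachable r03]
    ring
  · -- only 0~2: flip the cluster of a 1
    have r10 : ¬ H.Reachable (a 1) (a 0) := fun h' => r01 h'.symm
    have r12 : ¬ H.Reachable (a 1) (a 2) := fun h' => r01 (r02.trans h'.symm)
    have r13 : ¬ H.Reachable (a 1) (a 3) := fun h' => h (Or.inr (Or.inl ⟨r02, h'⟩))
    refine ⟨a 1, fun σ => ?_⟩
    simp only [spinMonomial, Fin.prod_univ_four, spinAt_flipCluster_of_not_reachable r10,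
      spinAt_flipCluster_of_reachable r11, spinAt_flipCluster_of_not_reachable r12,
      spinAt_flipCluster_of_not_reachable r13]
    ring
  · -- only 0~3: flip the cluster of a 1
    have r10 : ¬ H.Reachable (a 1) (a 0) := fun h' => r01 h'.symm
    have r12 : ¬ H.Reachable (a 1) (a 2) := fun h' => h (Or.inr (Or.inr ⟨r03, h'⟩))
    have r13 : ¬ H.Reachable (a 1) (a 3) := fun h' => r01 (r03.trans h'.symm)
    refine ⟨a 1, fun σ => ?_⟩
    simp only [spinMonomial, Fin.prod_univ_four, spinAt_flipCluster_of_not_reachable r10,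
      spinAt_flipCluster_of_reachable r11, spinAt_flipCluster_of_not_reachable r12,
      spinAt_flipCluster_of_not_reachable r13]
    ring
  · refine ⟨a 0, fun σ => ?_⟩
    simp only [spinMonomial, Fin.prod_univ_four, spinAt_flipCluster_of_reachable r00,
      spinAt_flipCluster_of_not_reachable r01, spinAt_flipCluster_of_not_reachable r02,
      spinAt_flipCluster_of_not_reachable r03]
    ring

variable [Fintype V] [DecidableEq V]

/-- Even case of the spin sum (Grimmett 2006, proof of Thm. 1.16, four points): if some pairing of
the marked vertices is realised by the clusters of `ω`, every cluster-constant configuration has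
`σ_{a0}σ_{a1}σ_{a2}σ_{a3} = 1`, so `∑_σ 1_F(σ, ω) σ_A = 2^{k(ω)}`. [cite: Grimmett2006, §1.4 Thm. 1.16] -/
theorem sum_boole_bondSpin_mul_spinMonomial_of_even (ω : Finset (Sym2 V)) {a : Fin 4 → V}
    (h : ((openGraph (↑ω : BondConfig V)).Reachable (a 0) (a 1) ∧ (openGraph (↑ω : BondConfig V)).Reachable (a 2) (a 3)) ∨
      ((openGraph (↑ω : BondConfig V)).Reachable (a 0) (a 2) ∧ (openGraph (↑ω : BondConfig V)).Reachable (a 1) (a 3)) ∨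
      ((openGraph (↑ω : BondConfig V)).Reachable (a 0) (a 3) ∧ (openGraph (↑ω : BondConfig V)).Reachable (a 1) (a 2))) :
    ∑ σ : SpinConfig V, (if ∀ e ∈ ω, bondSpin σ e = 1 then (1 : ℝ) else 0) * spinMonomial a σ =
      (2 : ℝ) ^ clusterCount (↑ω : BondConfig V) ∅ := by
  rw [← sum_boole_bondSpin_eq ω]
  refine Finset.sum_congr rfl fun σ _ => ?_
  split_ifs with hF
  · rw [one_mul]
    have hconst := (forall_bondSpin_eq_one_iff ω σ).1 hF
    have key : ∀ {x y : V}, (openGraph (↑ω : BondConfig V)).Reachable x y → spinAt x σ = spinAt y σ :=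
      fun hxy => by simp [spinAt, apply_eq_of_reachable hconst hxy]
    simp only [spinMonomial, Fin.prod_univ_four]
    rcases h with ⟨h01, h23⟩ | ⟨h02, h13⟩ | ⟨h03, h12⟩
    · rw [key h01, key h23]
      rcases spinAt_eq_one_or_eq_neg_one (a 1) σ with h1 | h1 <;>
        rcases spinAt_eq_one_or_eq_neg_one (a 3) σ with h3 | h3 <;> norm_num [h1, h3]
    · rw [key h02, key h13]
      rcases spinAt_eq_one_or_eq_neg_one (a 2) σ with h1 | h1 <;>
        rcases spinAt_eq_one_or_eq_neg_one (a 3) σ with h3 | h3 <;> norm_num [h1, h3]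
    · rw [key h03, key h12]
      rcases spinAt_eq_one_or_eq_neg_one (a 2) σ with h1 | h1 <;>
        rcases spinAt_eq_one_or_eq_neg_one (a 3) σ with h3 | h3 <;> norm_num [h1, h3]
  · rw [zero_mul]

/-- Odd case of the spin sum (Grimmett 2006, proof of Thm. 1.16, four points): if no pairing is
realised, flipping the cluster of a suitable vertex is an involution of the cluster-constant
configurations reversing the sign of `σ_A`, so `∑_σ 1_F(σ, ω) σ_A = 0`. [cite: Grimmett2006, §1.4 Thm. 1.16] -/
theorem sum_boole_bondSpin_mul_spinMonomial_of_not_even (ω : Finset (Sym2 V)) {a : Fin 4 → V}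
    (h : ¬ (((openGraph (↑ω : BondConfig V)).Reachable (a 0) (a 1) ∧ (openGraph (↑ω : BondConfig V)).Reachable (a 2) (a 3)) ∨
      ((openGraph (↑ω : BondConfig V)).Reachable (a 0) (a 2) ∧ (openGraph (↑ω : BondConfig V)).Reachable (a 1) (a 3)) ∨
      ((openGraph (↑ω : BondConfig V)).Reachable (a 0) (a 3) ∧ (openGraph (↑ω : BondConfig V)).Reachable (a 1) (a 2)))) :
    ∑ σ : SpinConfig V, (if ∀ e ∈ ω, bondSpin σ e = 1 then (1 : ℝ) else 0) * spinMonomial a σ = 0 := by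
  obtain ⟨v, hv⟩ := exists_flipCluster_neg h
  have hφi : Function.Involutive (flipCluster (openGraph (↑ω : BondConfig V)) v) :=
    flipCluster_involutive _ v
  have hS : ∑ σ : SpinConfig V, (if ∀ e ∈ ω, bondSpin σ e = 1 then (1 : ℝ) else 0) * spinMonomial a σ =
      ∑ σ : SpinConfig V,
        (if ∀ e ∈ ω, bondSpin (flipCluster (openGraph (↑ω : BondConfig V)) v σ) e = 1 then (1 : ℝ) else 0) *
          spinMonomial a (flipCluster (openGraph (↑ω : BondConfig V)) v σ) :=
    (Fintype.sum_equiv (Function.Involutive.toPerm _ hφi) _ _ fun σ => rfl).symm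
  simp_rw [forall_bondSpin_flipCluster_iff, hv, mul_neg, Finset.sum_neg_distrib] at hS
  linarith

variable (G : SimpleGraph V) [DecidableRel G.Adj]

omit [Fintype V] [DecidableEq V] in
/-- Exchange of the `σ`- and `ω`-sums in the numerator. [folklore] -/
theorem sum_mul_sum_mul_comm₄ {ι κ : Type*} (s : Finset ι) (t : Finset κ) (c : ℝ) (W : κ → ℝ)
    (b : κ → ι → ℝ) (g : ι → ℝ) :
    ∑ i ∈ s, (c * ∑ k ∈ t, W k * b k i) * g i = c * ∑ k ∈ t, W k * ∑ i ∈ s, b k i * g i := by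
  simp_rw [Finset.mul_sum, Finset.sum_mul]
  rw [Finset.sum_comm]
  refine Finset.sum_congr rfl fun k _ => Finset.sum_congr rfl fun i _ => ?_
  ring

omit [Fintype V] [DecidableEq V] in
/-- Exchange of the `σ`- and `ω`-sums in the partition function. [folklore] -/
theorem sum_mul_sum_comm₄ {ι κ : Type*} (s : Finset ι) (t : Finset κ) (c : ℝ) (W : κ → ℝ)
    (b : κ → ι → ℝ) :
    ∑ i ∈ s, c * ∑ k ∈ t, W k * b k i = c * ∑ k ∈ t, W k * ∑ i ∈ s, b k i := by
  simp_rw [Finset.mul_sum]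
  rw [Finset.sum_comm]

/-- **Edwards–Sokal identity for the four-point function** (Edwards–Sokal 1988; Grimmett 2006,
Thm. 1.16, four points; Aizenman 1982, §5): for the free-boundary, zero-field Ising model on a
finite graph at `β ≥ 0`,
`⟨σ_{a0}σ_{a1}σ_{a2}σ_{a3}⟩ = φ_{G,1-e^{-2β},2}(every open cluster holds an even number of the aᵢ)`,
the event being the union of the three pairing events `{a_i↔a_j} ∩ {a_k↔a_l}`.
[cite: Grimmett2006, §1.4 Thm. 1.16] -/
theorem edwardsSokal_fourPoint {β : ℝ} (hβ : 0 ≤ β) (a : Fin 4 → V) :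
    isingExpect G univ β 0 .free (spinMonomial a) =
      (rcMeasure G (fkIsingParam β) 2 ∅).real
        (((openConn (a 0) (a 1) ∩ openConn (a 2) (a 3)) ∪ (openConn (a 0) (a 2) ∩ openConn (a 1) (a 3))) ∪
          (openConn (a 0) (a 3) ∩ openConn (a 1) (a 2))) := by
  classical
  have hp : fkIsingParam β ∈ Set.Icc (0 : ℝ) 1 := fkIsingParam_mem_Icc hβ
  have hq : (0 : ℝ) < 2 := two_pos
  have hc : (0 : ℝ) < Real.exp β ^ #G.edgeFinset := pow_pos (Real.exp_pos β) _
  rw [rcMeasure_real_apply G hp hq ∅, ← Finset.sum_filter, ← Finset.sum_div, Finset.sum_filter,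
    isingExpect_univ_free_eq G β (measurable_spinMonomial a)]
  simp_rw [exp_mul_sum_bondSpin_eq G β]
  rw [sum_mul_sum_mul_comm₄, sum_mul_sum_comm₄, mul_div_mul_left _ _ hc.ne']
  congr 1
  · refine Finset.sum_congr rfl fun ω _ => ?_
    by_cases hr : ((openGraph (↑ω : BondConfig V)).Reachable (a 0) (a 1) ∧ (openGraph (↑ω : BondConfig V)).Reachable (a 2) (a 3)) ∨
      ((openGraph (↑ω : BondConfig V)).Reachable (a 0) (a 2) ∧ (openGraph (↑ω : BondConfig V)).Reachable (a 1) (a 3)) ∨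
      ((openGraph (↑ω : BondConfig V)).Reachable (a 0) (a 3) ∧ (openGraph (↑ω : BondConfig V)).Reachable (a 1) (a 2))
    · have hmem : (↑ω : BondConfig V) ∈ (((openConn (a 0) (a 1) ∩ openConn (a 2) (a 3)) ∪
          (openConn (a 0) (a 2) ∩ openConn (a 1) (a 3))) ∪ (openConn (a 0) (a 3) ∩ openConn (a 1) (a 2))) := by
        simpa [Set.mem_union, Set.mem_inter_iff, openConn, or_assoc] using hr
      rw [if_pos hmem, sum_boole_bondSpin_mul_spinMonomial_of_even ω hr]
      rfl
    · have hmem : (↑ω : BondConfig V) ∉ (((openConn (a 0) (a 1) ∩ openConn (a 2) (a 3)) ∪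
          (openConn (a 0) (a 2) ∩ openConn (a 1) (a 3))) ∪ (openConn (a 0) (a 3) ∩ openConn (a 1) (a 2))) := by
        simpa [Set.mem_union, Set.mem_inter_iff, openConn, or_assoc] using hr
      rw [if_neg hmem, sum_boole_bondSpin_mul_spinMonomial_of_not_even ω hr, mul_zero]
  · unfold rcPartitionFunction
    refine Finset.sum_congr rfl fun ω _ => ?_
    rw [sum_boole_bondSpin_eq]
    rfl

end EdwardsSokalFour


/-! ## 1c. The Lebowitz sandwich in spin language: `−2·φ(ALL) ≤ U₄^free_G(a)` on every finite graph -/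

section SpinSandwich

variable {V : Type*} [Fintype V] [DecidableEq V] (G : SimpleGraph V) [DecidableRel G.Adj]

/-- **`|U₄| ≤ 2P₄` on every finite graph** (Aizenman 1982, Prop. 5.3 in FK dress): for the free,
zero-field Ising model on a finite graph at `β ≥ 0` and any four sites `a`,
`−2·φ_{G,p,2}(a all joined) ≤ U₄(a) = ⟨σ_A⟩ − Σ_π ⟨σσ⟩⟨σσ⟩` with `p = 1 − e^{−2β}`.
Edwards–Sokal (two- and four-point) + FKG + counting. Combined with the route's `ParityBound`
(`U₄ ≤ −2∫u dφ`) this is the sandwich `2∫u dφ ≤ |U₄| ≤ 2P₄`; it makes `FKFourConnectivity`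
necessary for every lattice bound `|U₄(A_l)| ≥ c·G²`. [cite: AizenmanCMP1982, Prop. 5.3] -/
theorem neg_two_mul_allJoined_le_connectedFour {β : ℝ} (hβ : 0 ≤ β) (a : Fin 4 → V) :
    -(2 * (rcMeasure G (fkIsingParam β) 2 ∅).real {ω | ∀ i j, (openGraph ω).Reachable (a i) (a j)}) ≤
      connectedFour (isingMeasure G univ β 0 .free) spinAt a := by
  have hp : fkIsingParam β ∈ Set.Icc (0 : ℝ) 1 := fkIsingParam_mem_Icc hβ
  have hq : (1 : ℝ) ≤ 2 := by norm_num
  have h4 : nPoint (isingMeasure G univ β 0 .free) spinAt a =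
      (rcMeasure G (fkIsingParam β) 2 ∅).real
        (((openConn (a 0) (a 1) ∩ openConn (a 2) (a 3)) ∪ (openConn (a 0) (a 2) ∩ openConn (a 1) (a 3))) ∪
          (openConn (a 0) (a 3) ∩ openConn (a 1) (a 2))) :=
    edwardsSokal_fourPoint G hβ a
  have h2 : ∀ x y : V, twoPoint (isingMeasure G univ β 0 .free) spinAt x y =
      (rcMeasure G (fkIsingParam β) 2 ∅).real (openConn x y) := fun x y =>
    edwardsSokal_twoPoint_holds G hβ x y
  have hs := pairProducts_sub_even_le_two_mul_allJoined G hp hq ∅ a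
  simp only [connectedFour, h4, h2]
  simp only [evenJoined, pairJoined, allJoined] at hs
  linarith

/-- **Ceiling on the crux's constant** (Lebowitz 1974 / Aizenman 1982 Prop. 5.2 in FK dress): on
every finite graph, `φ_{G,p,2}(ALL) ≤ φ(EVEN) = ⟨σ_A⟩ ≤ Σ_π ⟨σσ⟩⟨σσ⟩ = Σ_π φ(a_i↔a_j)φ(a_k↔a_l)`
(`ALL ⊆ EVEN`, Edwards–Sokal four-point, Lebowitz `U₄ ≤ 0` = `lebowitz_holds`, Edwards–Sokal
two-point). For the crux's tetrahedron the six pair-connectivities coincide (cubic symmetry), so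
`r(l) = P₄/(G₀₁G₂₃) ≤ 3`: no constant `c > 3` can ever work — the statement is tight up to the value of
`r* ∈ (0, 3]`. [cite: Lebowitz1974, Theorem, eq. (2.5b)] -/
theorem allJoined_le_sum_pairProducts {β : ℝ} (hβ : 0 ≤ β) (a : Fin 4 → V) :
    (rcMeasure G (fkIsingParam β) 2 ∅).real {ω | ∀ i j, (openGraph ω).Reachable (a i) (a j)} ≤
      (rcMeasure G (fkIsingParam β) 2 ∅).real (openConn (a 0) (a 1)) *
          (rcMeasure G (fkIsingParam β) 2 ∅).real (openConn (a 2) (a 3))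
        + (rcMeasure G (fkIsingParam β) 2 ∅).real (openConn (a 0) (a 2)) *
          (rcMeasure G (fkIsingParam β) 2 ∅).real (openConn (a 1) (a 3))
        + (rcMeasure G (fkIsingParam β) 2 ∅).real (openConn (a 0) (a 3)) *
          (rcMeasure G (fkIsingParam β) 2 ∅).real (openConn (a 1) (a 2)) := by
  have hp : fkIsingParam β ∈ Set.Icc (0 : ℝ) 1 := fkIsingParam_mem_Icc hβ
  haveI := isProbabilityMeasure_rcMeasure G hp two_pos (∅ : Set V)
  have hsub : {ω : BondConfig V | ∀ i j, (openGraph ω).Reachable (a i) (a j)} ⊆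
      (((openConn (a 0) (a 1) ∩ openConn (a 2) (a 3)) ∪ (openConn (a 0) (a 2) ∩ openConn (a 1) (a 3))) ∪
        (openConn (a 0) (a 3) ∩ openConn (a 1) (a 2))) :=
    fun ω hω => Or.inl (Or.inl ⟨hω 0 1, hω 2 3⟩)
  have hmono := measureReal_mono (μ := rcMeasure G (fkIsingParam β) 2 ∅) hsub (measure_ne_top _ _)
  have h4 : nPoint (isingMeasure G univ β 0 .free) spinAt a =
      (rcMeasure G (fkIsingParam β) 2 ∅).real
        (((openConn (a 0) (a 1) ∩ openConn (a 2) (a 3)) ∪ (openConn (a 0) (a 2) ∩ openConn (a 1) (a 3))) ∪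
          (openConn (a 0) (a 3) ∩ openConn (a 1) (a 2))) :=
    edwardsSokal_fourPoint G hβ a
  have h2 : ∀ x y : V, twoPoint (isingMeasure G univ β 0 .free) spinAt x y =
      (rcMeasure G (fkIsingParam β) 2 ∅).real (openConn x y) := fun x y =>
    edwardsSokal_twoPoint_holds G hβ x y
  have hleb := lebowitz_holds G hβ univ a (fun _ => Finset.mem_univ _)
  simp only [connectedFour, h4, h2] at hleb
  linarith

end SpinSandwich

/-! ## 2. The crux itself: reformulations, the junk regime, and what a refutation would mean -/

section Crux

open scoped Classical

/-- The tetrahedral shape of the crux: alternate corners of the cube `{±1}³`, a regular tetrahedron of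
side `2√2` permuted transitively by the 24 rotations of the cube. -/
def tetra : Fin 4 → Site 3 := ![![-1, -1, -1], ![1, 1, -1], ![1, -1, 1], ![-1, 1, 1]]

/-- The nearest-neighbour graph induced on the box `Λ_N = {−N..N}³` (as in the crux). -/
abbrev boxGraph (N : ℕ) : SimpleGraph ↥(box 3 N) :=
  (zdGraph 3).comap (Subtype.val : ↥(box 3 N) → Site 3)

/-- The free FK measure of `Λ_N` at edge density `fkIsingParam β`, `q = 2` (the crux takes `β = β_c(3)`). -/
abbrev fkBox (β : ℝ) (N : ℕ) : Measure (BondConfig ↥(box 3 N)) :=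
  rcMeasure (boxGraph N) (fkIsingParam β) 2 ∅

/-- The crux, with the inverse temperature as a parameter (`FKFourAt (criticalBeta 3)` is the crux
verbatim, see `fkFourAt_criticalBeta_iff`). -/
def FKFourAt (β : ℝ) : Prop :=
  ∃ c : ℝ, 0 < c ∧ ∀ l : ℕ, 1 ≤ l → ∃ N₀ : ℕ, ∀ N : ℕ, N₀ ≤ N → ∀ a : Fin 4 → ↥(box 3 N),
    (∀ i, ((a i : Site 3)) = (l : ℤ) • tetra i) →
      c * (fkBox β N).real (openConn (a 0) (a 1)) * (fkBox β N).real (openConn (a 2) (a 3)) ≤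
        (fkBox β N).real (allJoined a)

/-- Read-back check: the parametrised form at `β = criticalBeta 3` IS the crux (definitional). -/
theorem fkFourAt_criticalBeta_iff :
    FKFourAt (criticalBeta 3) ↔
      Summit.CriticalPhenomena.Ising3DConformalLimit.Theses.FKParityRobustness.FKFourConnectivity :=
  Iff.rfl

/-- The four pinned sites are pairwise distinct as soon as `1 ≤ l` (coordinates `±l`). -/
theorem pinned_ne {l : ℕ} (hl : 1 ≤ l) {N : ℕ} {a : Fin 4 → ↥(box 3 N)}
    (ha : ∀ i, ((a i : Site 3)) = (l : ℤ) • tetra i) {i j : Fin 4} (hij : i ≠ j) : a i ≠ a j := by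
  intro h
  have h' : (l : ℤ) • tetra i = (l : ℤ) • tetra j := by rw [← ha i, ← ha j, h]
  have hl0 : (l : ℤ) ≠ 0 := by exact_mod_cast Nat.one_le_iff_ne_zero.1 hl
  have key : tetra i = tetra j := by
    funext k
    have := congrFun h' k
    simp only [Pi.smul_apply, smul_eq_mul] at this
    exact mul_left_cancel₀ hl0 this
  fin_cases i <;> fin_cases j <;> first | exact hij rfl | (have := congrFun key 0; have := congrFun key 1; simp [tetra] at *)

/-- **Junk regime is harmless but uninformative**: at `β = 0` (edge density `0`, `φ = δ_∅`) the crux's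
inequality holds trivially (`c·0·0 ≤ 0`). So the statement is "true for the wrong reason" exactly when
`criticalBeta 3 = 0`, which `criticalBeta_pos_holds` excludes; neither a refutation nor a cheap proof
can come from degenerate parameters. -/
theorem fkFourAt_zero : FKFourAt 0 := by
  refine ⟨1, one_pos, fun l hl => ⟨0, fun N _ a ha => ?_⟩⟩
  have h01 : a 0 ≠ a 1 := pinned_ne hl ha (by decide)
  have hμ : fkBox 0 N = Measure.dirac (∅ : BondConfig ↥(box 3 N)) := by
    rw [fkBox, fkIsingParam_zero]
    exact rcMeasure_zero_eq_dirac (boxGraph N) two_pos ∅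
  rw [hμ, dirac_empty_real_openConn h01]
  simp only [mul_zero, zero_mul]
  exact measureReal_nonneg

/-- **What a refutation of the crux would mean** (the standing disprover's bottom line, kernel-checked):
if `FKFourConnectivity` fails then for every `c > 0` there are tetrahedra `A_l` (some `l ≥ 1`), in
arbitrarily large free boxes, at which the FK-side Ursell combination
`Σ_π φ(a_i↔a_j)φ(a_k↔a_l) − φ(EVEN)` — equal to `−U₄(A_l) = |U₄(A_l)|` by Edwards–Sokal — is
`< 2c·φ(a₀↔a₁)φ(a₂↔a₃)`. I.e. `liminf_l |U₄(A_l)|/G(2√2 l)² = 0`: POINTWISE TRIVIALITY of the critical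
3D Ising four-point function along tetrahedra, against the conjectured (bootstrap-measured) non-Gaussian
scaling limit. This is why the crux resists disproof: any counterexample is a triviality theorem for
3D Ising. Conversely the crux is NECESSARY for the route (`|U₄| ≤ 2P₄`). -/
theorem not_FKFourConnectivity_imp_pointwise_fk_triviality
    (hn : ¬ Summit.CriticalPhenomena.Ising3DConformalLimit.Theses.FKParityRobustness.FKFourConnectivity)
    (c : ℝ) (hc : 0 < c) :
    ∃ l : ℕ, 1 ≤ l ∧ ∀ N₀ : ℕ, ∃ N : ℕ, N₀ ≤ N ∧ ∃ a : Fin 4 → ↥(box 3 N),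
      (∀ i, ((a i : Site 3)) = (l : ℤ) • tetra i) ∧
      (fkBox (criticalBeta 3) N).real (openConn (a 0) (a 1)) * (fkBox (criticalBeta 3) N).real (openConn (a 2) (a 3))
        + (fkBox (criticalBeta 3) N).real (openConn (a 0) (a 2)) * (fkBox (criticalBeta 3) N).real (openConn (a 1) (a 3))
        + (fkBox (criticalBeta 3) N).real (openConn (a 0) (a 3)) * (fkBox (criticalBeta 3) N).real (openConn (a 1) (a 2))
        - (fkBox (criticalBeta 3) N).real (evenJoined a)
        < 2 * c * ((fkBox (criticalBeta 3) N).real (openConn (a 0) (a 1)) *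
            (fkBox (criticalBeta 3) N).real (openConn (a 2) (a 3))) := by
  have hp : fkIsingParam (criticalBeta 3) ∈ Set.Icc (0 : ℝ) 1 :=
    fkIsingParam_mem_Icc (criticalBeta_nonneg 3)
  have hq : (1 : ℝ) ≤ 2 := by norm_num
  by_contra hcon
  push Not at hcon
  apply hn
  rw [← fkFourAt_criticalBeta_iff]
  refine ⟨c, hc, fun l hl => ?_⟩
  obtain ⟨N₀, hN₀⟩ := hcon l hl
  refine ⟨N₀, fun N hN a ha => ?_⟩
  exact crux_pointwise_of_U4bound (boxGraph N) hp hq ∅ a c (hN₀ N hN a ha)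

/-- **What a refutation would mean, in spin language** (kernel-checked bottom line): if the crux fails,
then for every `c > 0` there are tetrahedra `A_l` (`l ≥ 1`), in arbitrarily large boxes, where the free
finite-volume critical Ising four-point Ursell function satisfies
`|U₄^free_{Λ_N}(A_l)| = −U₄ < 2c·⟨σ_{a0}σ_{a1}⟩⟨σ_{a2}σ_{a3}⟩`: pointwise triviality along tetrahedra for
critical 3D Ising, the opposite of clause (iii) / the bootstrap value `g(u=v=1) < 3`. So a disproof of
`FKFourConnectivity` is a (pointwise, tetrahedral) triviality theorem in `d = 3`. -/
theorem not_FKFourConnectivity_imp_pointwise_triviality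
    (hn : ¬ Summit.CriticalPhenomena.Ising3DConformalLimit.Theses.FKParityRobustness.FKFourConnectivity)
    (c : ℝ) (hc : 0 < c) :
    ∃ l : ℕ, 1 ≤ l ∧ ∀ N₀ : ℕ, ∃ N : ℕ, N₀ ≤ N ∧ ∃ a : Fin 4 → ↥(box 3 N),
      (∀ i, ((a i : Site 3)) = (l : ℤ) • tetra i) ∧
      -(connectedFour (isingMeasure (boxGraph N) univ (criticalBeta 3) 0 .free) spinAt a) <
        2 * c * (isingTwoPoint (boxGraph N) univ (criticalBeta 3) 0 .free (a 0) (a 1) *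
          isingTwoPoint (boxGraph N) univ (criticalBeta 3) 0 .free (a 2) (a 3)) := by
  have hβ : 0 ≤ criticalBeta 3 := criticalBeta_nonneg 3
  by_contra hcon
  push Not at hcon
  apply hn
  rw [← fkFourAt_criticalBeta_iff]
  refine ⟨c, hc, fun l hl => ?_⟩
  obtain ⟨N₀, hN₀⟩ := hcon l hl
  refine ⟨N₀, fun N hN a ha => ?_⟩
  have h := hN₀ N hN a ha
  have hs := neg_two_mul_allJoined_le_connectedFour (boxGraph N) hβ a
  have e01 : isingTwoPoint (boxGraph N) univ (criticalBeta 3) 0 .free (a 0) (a 1) =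
      (fkBox (criticalBeta 3) N).real (openConn (a 0) (a 1)) :=
    edwardsSokal_twoPoint_holds (boxGraph N) hβ (a 0) (a 1)
  have e23 : isingTwoPoint (boxGraph N) univ (criticalBeta 3) 0 .free (a 2) (a 3) =
      (fkBox (criticalBeta 3) N).real (openConn (a 2) (a 3)) :=
    edwardsSokal_twoPoint_holds (boxGraph N) hβ (a 2) (a 3)
  rw [e01, e23] at h
  change c * (fkBox (criticalBeta 3) N).real (openConn (a 0) (a 1)) *
      (fkBox (criticalBeta 3) N).real (openConn (a 2) (a 3)) ≤ (fkBox (criticalBeta 3) N).real (allJoined a)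
  change -(2 * (fkBox (criticalBeta 3) N).real (allJoined a)) ≤ _ at hs
  nlinarith [hs, h]

/-! ### 2b. The crux is NECESSARY for the route's lattice bound (infinite volume, spin language) -/

open Filter Topology

/-- `univ.map val = Λ_N`: the whole vertex set of the box graph is the box. [folklore] -/
theorem univ_map_subtype_box (N : ℕ) :
    (Finset.univ : Finset ↥(box 3 N)).map (Function.Embedding.subtype _) = box 3 N := by
  rw [Finset.univ_eq_attach, Finset.attach_map_val]

/-- The box graph is the graph induced by `ℤ³` on `Λ_N` (adjacency transported along `val`). [folklore] -/
theorem boxGraph_adj_iff (N : ℕ) :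
    ∀ x ∈ (Finset.univ : Finset ↥(box 3 N)), ∀ y ∈ (Finset.univ : Finset ↥(box 3 N)),
      ((zdGraph 3).Adj ((Function.Embedding.subtype (· ∈ box 3 N)) x)
        ((Function.Embedding.subtype (· ∈ box 3 N)) y) ↔ (boxGraph N).Adj x y) :=
  fun _ _ _ _ => Iff.rfl

/-- Transport of two-point functions: the free Ising model of the box graph on its whole vertex set
is the free Ising model of `ℤ³` in the box. [cite: FriedliVelenik2017, §3.1, Def. 3.1] -/
theorem isingTwoPoint_boxGraph (N : ℕ) (β : ℝ) (x y : ↥(box 3 N)) :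
    isingTwoPoint (boxGraph N) univ β 0 .free x y =
      isingTwoPoint (zdGraph 3) (box 3 N) β 0 .free (x : Site 3) (y : Site 3) := by
  have h := isingTwoPoint_free_map (G := boxGraph N) (G' := zdGraph 3)
    (Function.Embedding.subtype (· ∈ box 3 N)) (Λ := univ) (boxGraph_adj_iff N) β 0 x y
  rw [univ_map_subtype_box] at h
  exact h.symm

/-- Transport of spin-monomial expectations along `val`. [cite: FriedliVelenik2017, §3.1, Def. 3.1] -/
theorem isingExpect_spinMonomial_boxGraph (N : ℕ) (β : ℝ) {n : ℕ} (a : Fin n → ↥(box 3 N)) :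
    isingExpect (boxGraph N) univ β 0 .free (spinMonomial a) =
      isingExpect (zdGraph 3) (box 3 N) β 0 .free (spinMonomial (fun i => (a i : Site 3))) := by
  have h := isingExpect_free_map (G := boxGraph N) (G' := zdGraph 3)
    (Function.Embedding.subtype (· ∈ box 3 N)) (Λ := univ) (boxGraph_adj_iff N) β 0
    (measurable_spinMonomial (fun i => (a i : Site 3)))
  rw [univ_map_subtype_box] at h
  rw [h]
  congr 1
  funext σ
  have hx : ∀ x : ↥(box 3 N), spinAt (x : Site 3)
      (SpinConfig.extendAlong (Function.Embedding.subtype (· ∈ box 3 N)) σ) = spinAt x σ :=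
    fun x => spinAt_extendAlong _ σ x
  simp only [spinMonomial, hx]

/-- Transport of the four-point Ursell function along `val`. [cite: FriedliVelenik2017, §3.1, Def. 3.1] -/
theorem connectedFour_boxGraph (N : ℕ) (β : ℝ) (a : Fin 4 → ↥(box 3 N)) :
    connectedFour (isingMeasure (boxGraph N) univ β 0 .free) spinAt a =
      connectedFour (isingMeasure (zdGraph 3) (box 3 N) β 0 .free) spinAt (fun i => (a i : Site 3)) := by
  have h4 : nPoint (isingMeasure (boxGraph N) univ β 0 .free) spinAt a =
      nPoint (isingMeasure (zdGraph 3) (box 3 N) β 0 .free) spinAt (fun i => (a i : Site 3)) :=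
    isingExpect_spinMonomial_boxGraph N β a
  have h2 : ∀ x y : ↥(box 3 N), twoPoint (isingMeasure (boxGraph N) univ β 0 .free) spinAt x y =
      twoPoint (isingMeasure (zdGraph 3) (box 3 N) β 0 .free) spinAt (x : Site 3) (y : Site 3) :=
    fun x y => isingTwoPoint_boxGraph N β x y
  simp only [connectedFour, h4, h2]

/-- The analytic step: at a fixed injective lattice quadruple `y`, an infinite-volume bound
`U₄^crit(y) ≤ −c·G(y₀,y₁)G(y₂,y₃)` passes to all large free boxes with constant `c/8`
(box limits `criticalCorr_wellDefined_holds`, positivity of the critical two-point function from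
`criticalTwoPoint_bounds_holds`). [cite: AizenmanDuminilCopinSidoraviciusCMP2015, Thm. 1.1] -/
theorem eventually_box_bound_of_latticeBound (y : Fin 4 → Site 3) (hy : Function.Injective y)
    (c : ℝ) (hc : 0 < c)
    (hb : criticalCorr 3 4 y - (criticalCorr 3 2 ![y 0, y 1] * criticalCorr 3 2 ![y 2, y 3]
        + criticalCorr 3 2 ![y 0, y 2] * criticalCorr 3 2 ![y 1, y 3]
        + criticalCorr 3 2 ![y 0, y 3] * criticalCorr 3 2 ![y 1, y 2]) ≤
      -(c * (criticalCorr 3 2 ![y 0, y 1] * criticalCorr 3 2 ![y 2, y 3]))) :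
    ∃ N₀ : ℕ, ∀ N : ℕ, N₀ ≤ N →
      c / 8 * (isingTwoPoint (zdGraph 3) (box 3 N) (criticalBeta 3) 0 .free (y 0) (y 1) *
          isingTwoPoint (zdGraph 3) (box 3 N) (criticalBeta 3) 0 .free (y 2) (y 3)) ≤
        -(connectedFour (isingMeasure (zdGraph 3) (box 3 N) (criticalBeta 3) 0 .free) spinAt y) / 2 := by
  classical
  have hU := tendsto_connectedFour_box_criticalBeta (d := 3) le_rfl y
  have hmem : (BoundaryCondition.free : BoundaryCondition (Site 3)) ∈
      ({.free, .plus, .minus} : Set (BoundaryCondition (Site 3))) := by simp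
  have hT : ∀ i j : Fin 4, Tendsto (fun L : ℕ => isingTwoPoint (zdGraph 3) (box 3 L) (criticalBeta 3) 0
      .free (y i) (y j)) atTop (𝓝 (criticalCorr 3 2 ![y i, y j])) := by
    intro i j
    have h := criticalCorr_wellDefined_holds (d := 3) le_rfl 2 ![y i, y j] .free hmem
    refine Tendsto.congr (fun L => ?_) h
    simp only [isingTwoPoint, spinMonomial_two]
  have hGpos : ∀ i j : Fin 4, i ≠ j → 0 < criticalCorr 3 2 ![y i, y j] := by
    intro i j hij
    rw [criticalCorr_two_pair]
    obtain ⟨c₀, C₀, hc₀, hbd⟩ := criticalTwoPoint_bounds_holds (d := 3) le_rfl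
    have hne : y j - y i ≠ 0 := sub_ne_zero.2 fun h => hij (hy h).symm
    have hnorm : 0 < (‖y j - y i‖ : ℝ) := norm_pos_iff.2 hne
    exact lt_of_lt_of_le (mul_pos hc₀ (Real.rpow_pos_of_pos hnorm _)) (hbd (y j - y i) hne).1
  have hPpos : 0 < criticalCorr 3 2 ![y 0, y 1] * criticalCorr 3 2 ![y 2, y 3] :=
    mul_pos (hGpos 0 1 (by decide)) (hGpos 2 3 (by decide))
  have h02 : 0 ≤ criticalCorr 3 2 ![y 0, y 2] * criticalCorr 3 2 ![y 1, y 3] :=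
    mul_nonneg (criticalCorr_two_nonneg _ _) (criticalCorr_two_nonneg _ _)
  have h03 : 0 ≤ criticalCorr 3 2 ![y 0, y 3] * criticalCorr 3 2 ![y 1, y 2] :=
    mul_nonneg (criticalCorr_two_nonneg _ _) (criticalCorr_two_nonneg _ _)
  set P := criticalCorr 3 2 ![y 0, y 1] * criticalCorr 3 2 ![y 2, y 3] with hP
  have ev1 : ∀ᶠ L : ℕ in atTop, connectedFour (isingMeasure (zdGraph 3) (box 3 L) (criticalBeta 3) 0 .free)
      spinAt y < -(c * P / 2) :=
    (tendsto_order.1 hU).2 _ (by nlinarith)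
  have ev2 : ∀ᶠ L : ℕ in atTop, isingTwoPoint (zdGraph 3) (box 3 L) (criticalBeta 3) 0 .free (y 0) (y 1) *
      isingTwoPoint (zdGraph 3) (box 3 L) (criticalBeta 3) 0 .free (y 2) (y 3) < 2 * P :=
    (tendsto_order.1 ((hT 0 1).mul (hT 2 3))).2 _ (by linarith)
  obtain ⟨N₀, hN₀⟩ := Filter.eventually_atTop.1 (ev1.and ev2)
  refine ⟨N₀, fun N hN => ?_⟩
  obtain ⟨h1, h2⟩ := hN₀ N hN
  nlinarith

/-- **The crux is necessary for the route's lattice bound** (kernel-checked kill criterion): if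
`FKFourConnectivity` fails then the conclusion of the route's `LatticeBoundFromFK` — the hypothesis
of `FarMergingGivesU4` at the tetrahedral shape, `U₄^crit(A_l) ≤ −c·⟨σσ⟩⟨σσ⟩` for all `l ≥ 1` — is
FALSE. Chain: lattice bound ⇒ (box limits at `β_c`, positivity of `⟨σσ⟩_{β_c}`) the same bound in
large free boxes with `c/8` ⇒ (transport to the box graph, Edwards–Sokal, `|U₄| ≤ 2P₄`) the crux.
So refuting the crux moots EVERY pointwise-tetrahedral attack on clause (iii), exactly as the
planner's KILL CRITERIA say; equivalently the crux is the weakest statement on that line.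
[cite: AizenmanCMP1982, Prop. 5.3] -/
theorem not_FKFourConnectivity_imp_not_latticeBound
    (hn : ¬ Summit.CriticalPhenomena.Ising3DConformalLimit.Theses.FKParityRobustness.FKFourConnectivity) :
    ¬ (∃ c : ℝ, 0 < c ∧ ∀ l : ℕ, 1 ≤ l →
        criticalCorr 3 4 (fun i => (l : ℤ) • tetra i) -
          (criticalCorr 3 2 ![(l : ℤ) • tetra 0, (l : ℤ) • tetra 1] * criticalCorr 3 2 ![(l : ℤ) • tetra 2, (l : ℤ) • tetra 3]
          + criticalCorr 3 2 ![(l : ℤ) • tetra 0, (l : ℤ) • tetra 2] * criticalCorr 3 2 ![(l : ℤ) • tetra 1, (l : ℤ) • tetra 3]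
          + criticalCorr 3 2 ![(l : ℤ) • tetra 0, (l : ℤ) • tetra 3] * criticalCorr 3 2 ![(l : ℤ) • tetra 1, (l : ℤ) • tetra 2]) ≤
        -(c * (criticalCorr 3 2 ![(l : ℤ) • tetra 0, (l : ℤ) • tetra 1] *
          criticalCorr 3 2 ![(l : ℤ) • tetra 2, (l : ℤ) • tetra 3]))) := by
  rintro ⟨c, hc, hb⟩
  apply hn
  rw [← fkFourAt_criticalBeta_iff]
  refine ⟨c / 8, by positivity, fun l hl => ?_⟩
  have hβ : 0 ≤ criticalBeta 3 := criticalBeta_nonneg 3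
  -- injectivity of the pinned quadruple
  have hinj : Function.Injective (fun i : Fin 4 => (l : ℤ) • tetra i) := by
    intro i j hij
    by_contra hne
    have hl0 : (l : ℤ) ≠ 0 := by exact_mod_cast Nat.one_le_iff_ne_zero.1 hl
    have key : tetra i = tetra j := by
      funext k
      have := congrFun hij k
      simp only [Pi.smul_apply, smul_eq_mul] at this
      exact mul_left_cancel₀ hl0 this
    fin_cases i <;> fin_cases j <;> first | exact hne rfl | (have := congrFun key 0; have := congrFun key 1; simp [tetra] at *)
  obtain ⟨N₀, hN₀⟩ := eventually_box_bound_of_latticeBound (fun i => (l : ℤ) • tetra i) hinj c hc (hb l hl)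
  refine ⟨N₀, fun N hN a ha => ?_⟩
  have hbox := hN₀ N hN
  have hay : (fun i => (a i : Site 3)) = fun i => (l : ℤ) • tetra i := funext ha
  -- the crux's quantities, transported to `ℤ³` in the box
  have tU := connectedFour_boxGraph N (criticalBeta 3) a
  have t01 := isingTwoPoint_boxGraph N (criticalBeta 3) (a 0) (a 1)
  have t23 := isingTwoPoint_boxGraph N (criticalBeta 3) (a 2) (a 3)
  rw [hay] at tU
  rw [ha 0, ha 1] at t01
  rw [ha 2, ha 3] at t23
  have hs := neg_two_mul_allJoined_le_connectedFour (boxGraph N) hβ a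
  have e01 : isingTwoPoint (boxGraph N) univ (criticalBeta 3) 0 .free (a 0) (a 1) =
      (fkBox (criticalBeta 3) N).real (openConn (a 0) (a 1)) :=
    edwardsSokal_twoPoint_holds (boxGraph N) hβ (a 0) (a 1)
  have e23 : isingTwoPoint (boxGraph N) univ (criticalBeta 3) 0 .free (a 2) (a 3) =
      (fkBox (criticalBeta 3) N).real (openConn (a 2) (a 3)) :=
    edwardsSokal_twoPoint_holds (boxGraph N) hβ (a 2) (a 3)
  change c / 8 * (fkBox (criticalBeta 3) N).real (openConn (a 0) (a 1)) *
      (fkBox (criticalBeta 3) N).real (openConn (a 2) (a 3)) ≤ (fkBox (criticalBeta 3) N).real (allJoined a)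
  change -(2 * (fkBox (criticalBeta 3) N).real (allJoined a)) ≤ _ at hs
  rw [← e01, ← e23, t01, t23]
  rw [tU] at hs
  beta_reduce at hbox
  nlinarith [hbox, hs]

end Crux

end

end Summit.CriticalPhenomena.Ising3DConformalLimit.Cruxes.FKFourConnectivity.Disproof
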